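import Summits.PneNP.PneNP.Theorems.ConvexRankGatesConvexGateBlindExactLiftingTriangleOriginalSpace

/-!
# Triangle instance — pair split of the heaviness functional and the pair count (lead c6, THEOREM C√ step F5)

Support file for crux `ConvexGateBlind` (stmt-PneNP-10680), line `xor-door-perfect-completeness`, open stub
`stub_exactLifting`; part of the Lean route to THEOREM C√ (memo `THEOREM-C-sqrt.md` on the item: no-lift LP
relaxations of triangle-vs-cut need `e^{Ω(√t)}` inequalities for every margin `ε`).

* §1 `pm b = ±1`; the three PAIR FORMS `X₁₂, X₁₃, X₂₃` of an atom `v` at a colouring `x`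
  (`X₁₂ = Σ_w ± v(w)`, sign `= pm(x₁ w₁)·pm(x₂ w₂)`), and the pointwise identity
  `2·sgn = pm₁pm₂ + pm₁pm₃ + pm₂pm₃ − 1`, whence `2·heav x v = X₁₂ + X₁₃ + X₂₃ − mass v` (`two_mul_heav_eq`; no hypothesis
  on `x` or `v`).
* §2 For `v ≥ 0` each pair form is at most the mass, so a Mono-heavy colouring has SOME pair form `> mass/3`
  (`exists_pairForm_gt_of_monoHeavy`).
* §3 The pair forms are bilinear forms of the line-mass MARGINALS in the two block colourings concerned
  (`pairForm12_eq_bil` &c.), and the heavy set is covered accordingly: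
  `#heavySet v ≤ #balBlocks · (#S₁₂ + #S₁₃ + #S₂₃)`, `S_ij` = pairs of block colourings (not required balanced) whose
  bilinear form of the `(i,j)`-marginal exceeds `mass/3` (`card_heavySet_le_pairs`).  This is the reduction of LEMMA N to
  ONE bilinear Rademacher form per pair; the tail of that form is the analytic step (F2–F3).

Nothing here is cited; everything is elementary.
-/

set_option linter.dupNamespace false -- `Summit.PneNP.PneNP.…`: summit = sub-problem (D-0017)

namespace Summit.PneNP.PneNP.Theorems.XorDoor.TriLine.Heavy

open Finset Classical

noncomputable section

variable {t : ℕ}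

/-! ## §1 Pair forms and the split of `heav` -/

/-- the sign `±1` of a colour -/
def pm (b : Bool) : ℝ := if b then 1 else -1

/-- `pm true = 1` -/
@[simp] lemma pm_true : pm true = 1 := rfl
/-- `pm false = -1` -/
@[simp] lemma pm_false : pm false = -1 := rfl

/-- `pm b ^ 2 = 1` -/
lemma pm_mul_self (b : Bool) : pm b * pm b = 1 := by cases b <;> simp [pm]

/-- `|pm b| = 1`-type bound used for `|X| ≤ mass` -/
lemma abs_pm (b : Bool) : |pm b| = 1 := by cases b <;> simp [pm]

/-- total mass of an atom -/
def mass (v : Tri t → ℝ) : ℝ := ∑ w, v w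

/-- the `(1,2)` pair form -/
def pairForm12 (x : Col t) (v : Tri t → ℝ) : ℝ := ∑ w, pm (x.1 w.1) * pm (x.2.1 w.2.1) * v w
/-- the `(1,3)` pair form -/
def pairForm13 (x : Col t) (v : Tri t → ℝ) : ℝ := ∑ w, pm (x.1 w.1) * pm (x.2.2 w.2.2) * v w
/-- the `(2,3)` pair form -/
def pairForm23 (x : Col t) (v : Tri t → ℝ) : ℝ := ∑ w, pm (x.2.1 w.2.1) * pm (x.2.2 w.2.2) * v w

/-- the pointwise identity behind the split: `2·sgn = pm₁pm₂ + pm₁pm₃ + pm₂pm₃ − 1` -/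
lemma two_mul_sgn (x : Col t) (w : Tri t) :
    2 * sgn x w = pm (x.1 w.1) * pm (x.2.1 w.2.1) + pm (x.1 w.1) * pm (x.2.2 w.2.2) +
      pm (x.2.1 w.2.1) * pm (x.2.2 w.2.2) - 1 := by
  simp only [sgn, IsMono]
  rcases Bool.eq_false_or_eq_true (x.1 w.1) with h1 | h1 <;>
  rcases Bool.eq_false_or_eq_true (x.2.1 w.2.1) with h2 | h2 <;>
  rcases Bool.eq_false_or_eq_true (x.2.2 w.2.2) with h3 | h3 <;>
  simp [h1, h2, h3, pm] <;> norm_num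

/-- **Pair split of the heaviness functional**: `2·heav x v = X₁₂ + X₁₃ + X₂₃ − mass v`. -/
theorem two_mul_heav_eq (x : Col t) (v : Tri t → ℝ) :
    2 * heav x v = pairForm12 x v + pairForm13 x v + pairForm23 x v - mass v := by
  simp only [heav, pairForm12, pairForm13, pairForm23, mass, mul_sum, ← sum_add_distrib, ← sum_sub_distrib]
  refine sum_congr rfl fun w _ => ?_
  have := two_mul_sgn x w
  calc 2 * (sgn x w * v w) = (2 * sgn x w) * v w := by ring
    _ = _ := by rw [this]; ring

/-! ## §2 A heavy colouring has a large pair form -/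

/-- a pair form of a non-negative atom is at most its mass -/
lemma pairForm12_le_mass (x : Col t) {v : Tri t → ℝ} (hv : ∀ w, 0 ≤ v w) : pairForm12 x v ≤ mass v := by
  unfold pairForm12 mass
  refine sum_le_sum fun w _ => ?_
  have h1 : pm (x.1 w.1) * pm (x.2.1 w.2.1) ≤ 1 := by
    cases x.1 w.1 <;> cases x.2.1 w.2.1 <;> simp [pm]
  nlinarith [hv w]

/-- `X₁₃ ≤ mass` for a non-negative atom -/
lemma pairForm13_le_mass (x : Col t) {v : Tri t → ℝ} (hv : ∀ w, 0 ≤ v w) : pairForm13 x v ≤ mass v := by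
  unfold pairForm13 mass
  refine sum_le_sum fun w _ => ?_
  have h1 : pm (x.1 w.1) * pm (x.2.2 w.2.2) ≤ 1 := by
    cases x.1 w.1 <;> cases x.2.2 w.2.2 <;> simp [pm]
  nlinarith [hv w]

/-- `X₂₃ ≤ mass` for a non-negative atom -/
lemma pairForm23_le_mass (x : Col t) {v : Tri t → ℝ} (hv : ∀ w, 0 ≤ v w) : pairForm23 x v ≤ mass v := by
  unfold pairForm23 mass
  refine sum_le_sum fun w _ => ?_
  have h1 : pm (x.2.1 w.2.1) * pm (x.2.2 w.2.2) ≤ 1 := by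
    cases x.2.1 w.2.1 <;> cases x.2.2 w.2.2 <;> simp [pm]
  nlinarith [hv w]

/-- **A Mono-heavy colouring has some pair form above a third of the mass** (no sign hypothesis: if all three pair forms
are `≤ mass/3` then `2·heav ≤ 0`). -/
theorem exists_pairForm_gt_of_monoHeavy (x : Col t) (v : Tri t → ℝ) (h : MonoHeavy x v) :
    mass v / 3 < pairForm12 x v ∨ mass v / 3 < pairForm13 x v ∨ mass v / 3 < pairForm23 x v := by
  by_contra hcon
  simp only [not_or, not_lt] at hcon
  obtain ⟨h12, h13, h23⟩ := hcon
  have hsplit := two_mul_heav_eq x v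
  have hpos : 0 < heav x v := h
  linarith

/-! ## §3 Pair forms as bilinear forms of the marginals; the pair count -/

/-- the bilinear form of a `t × t` table in two block colourings: `Σ_{a,b} ± μ(a,b)` -/
def bil (μ : Fin t → Fin t → ℝ) (y y' : Fin t → Bool) : ℝ := ∑ a, ∑ b, pm (y a) * pm (y' b) * μ a b

/-- the `(1,2)` line-mass marginal: masses of the lines `{(a,b,·)}` -/
def marg12 (v : Tri t → ℝ) (a b : Fin t) : ℝ := ∑ d, v (a, b, d)
/-- the `(1,3)` marginal: lines `{(a,·,d)}` -/
def marg13 (v : Tri t → ℝ) (a d : Fin t) : ℝ := ∑ b, v (a, b, d)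
/-- the `(2,3)` marginal: lines `{(·,b,d)}` -/
def marg23 (v : Tri t → ℝ) (b d : Fin t) : ℝ := ∑ a, v (a, b, d)

/-- `X₁₂` is the bilinear form of the `(1,2)` marginal -/
lemma pairForm12_eq_bil (x : Col t) (v : Tri t → ℝ) : pairForm12 x v = bil (marg12 v) x.1 x.2.1 := by
  simp only [pairForm12, bil, marg12, Fintype.sum_prod_type, mul_sum]

/-- `X₁₃` is the bilinear form of the `(1,3)` marginal -/
lemma pairForm13_eq_bil (x : Col t) (v : Tri t → ℝ) : pairForm13 x v = bil (marg13 v) x.1 x.2.2 := by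
  simp only [pairForm13, bil, marg13, Fintype.sum_prod_type, mul_sum]
  refine sum_congr rfl fun a _ => ?_
  rw [sum_comm]

/-- `X₂₃` is the bilinear form of the `(2,3)` marginal -/
lemma pairForm23_eq_bil (x : Col t) (v : Tri t → ℝ) : pairForm23 x v = bil (marg23 v) x.2.1 x.2.2 := by
  simp only [pairForm23, bil, marg23, Fintype.sum_prod_type, mul_sum]
  rw [sum_comm]
  refine sum_congr rfl fun b _ => ?_
  rw [sum_comm]

/-- the balanced colourings of one block -/
def balBlocks (t : ℕ) : Finset (Fin t → Bool) := univ.filter fun y => BalBlock y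

/-- the pairs of block colourings on which a bilinear form exceeds `u` -/
def bigPairs (μ : Fin t → Fin t → ℝ) (u : ℝ) : Finset ((Fin t → Bool) × (Fin t → Bool)) :=
  univ.filter fun p => u < bil μ p.1 p.2

/-- counting a product-shaped subset of `Col t`: colourings whose first two blocks lie in `P` and third in `Q` -/
lemma card_filter_12 (P : (Fin t → Bool) → (Fin t → Bool) → Prop) (Q : (Fin t → Bool) → Prop) :
    #(univ.filter fun x : Col t => P x.1 x.2.1 ∧ Q x.2.2)
      = #(univ.filter fun p : (Fin t → Bool) × (Fin t → Bool) => P p.1 p.2) * #(univ.filter fun y => Q y) := by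
  rw [← card_product]
  refine card_bij' (fun x _ => ((x.1, x.2.1), x.2.2)) (fun q _ => (q.1.1, q.1.2, q.2)) ?_ ?_ ?_ ?_
  · intro x hx
    simp only [mem_filter, mem_univ, true_and] at hx
    simp [hx]
  · intro q hq
    simp only [mem_product, mem_filter, mem_univ, true_and] at hq
    simp [hq]
  · intro x _; rfl
  · intro q _; rfl

/-- product count, blocks `(1,3)` against block `2` -/
lemma card_filter_13 (P : (Fin t → Bool) → (Fin t → Bool) → Prop) (Q : (Fin t → Bool) → Prop) :
    #(univ.filter fun x : Col t => P x.1 x.2.2 ∧ Q x.2.1)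
      = #(univ.filter fun p : (Fin t → Bool) × (Fin t → Bool) => P p.1 p.2) * #(univ.filter fun y => Q y) := by
  rw [← card_product]
  refine card_bij' (fun x _ => ((x.1, x.2.2), x.2.1)) (fun q _ => (q.1.1, q.2, q.1.2)) ?_ ?_ ?_ ?_
  · intro x hx
    simp only [mem_filter, mem_univ, true_and] at hx
    simp [hx]
  · intro q hq
    simp only [mem_product, mem_filter, mem_univ, true_and] at hq
    simp [hq]
  · intro x _; rfl
  · intro q _; rfl

/-- product count, blocks `(2,3)` against block `1` -/
lemma card_filter_23 (P : (Fin t → Bool) → (Fin t → Bool) → Prop) (Q : (Fin t → Bool) → Prop) :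
    #(univ.filter fun x : Col t => P x.2.1 x.2.2 ∧ Q x.1)
      = #(univ.filter fun p : (Fin t → Bool) × (Fin t → Bool) => P p.1 p.2) * #(univ.filter fun y => Q y) := by
  rw [← card_product]
  refine card_bij' (fun x _ => ((x.2.1, x.2.2), x.1)) (fun q _ => (q.2, q.1.1, q.1.2)) ?_ ?_ ?_ ?_
  · intro x hx
    simp only [mem_filter, mem_univ, true_and] at hx
    simp [hx]
  · intro q hq
    simp only [mem_product, mem_filter, mem_univ, true_and] at hq
    simp [hq]
  · intro x _; rfl
  · intro q _; rfl

/-- **The pair count.**  For any atom `v`, the heavy set is covered by the three product sets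
"pair form of the `(i,j)`-marginal `> mass/3`, remaining block balanced", so
`#heavySet v ≤ #balBlocks · (#S₁₂ + #S₁₃ + #S₂₃)`. -/
theorem card_heavySet_le_pairs (v : Tri t → ℝ) :
    #(heavySet v) ≤ #(balBlocks t) * (#(bigPairs (marg12 v) (mass v / 3)) +
      #(bigPairs (marg13 v) (mass v / 3)) + #(bigPairs (marg23 v) (mass v / 3))) := by
  set u := mass v / 3 with hu
  have hcov : heavySet v ⊆
      (univ.filter fun x : Col t => (u < bil (marg12 v) x.1 x.2.1) ∧ BalBlock x.2.2) ∪
      (univ.filter fun x : Col t => (u < bil (marg13 v) x.1 x.2.2) ∧ BalBlock x.2.1) ∪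
      (univ.filter fun x : Col t => (u < bil (marg23 v) x.2.1 x.2.2) ∧ BalBlock x.1) := by
    intro x hx
    rw [mem_heavySet] at hx
    obtain ⟨hbal, hheavy⟩ := hx
    rcases exists_pairForm_gt_of_monoHeavy x v hheavy with h | h | h
    · refine mem_union_left _ (mem_union_left _ ?_)
      simp only [mem_filter, mem_univ, true_and]
      exact ⟨by rw [← pairForm12_eq_bil]; exact h, hbal.2.2⟩
    · refine mem_union_left _ (mem_union_right _ ?_)
      simp only [mem_filter, mem_univ, true_and]
      exact ⟨by rw [← pairForm13_eq_bil]; exact h, hbal.2.1⟩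
    · refine mem_union_right _ ?_
      simp only [mem_filter, mem_univ, true_and]
      exact ⟨by rw [← pairForm23_eq_bil]; exact h, hbal.1⟩
  have h1 := card_filter_12 (t := t) (fun y y' => u < bil (marg12 v) y y') BalBlock
  have h2 := card_filter_13 (t := t) (fun y y' => u < bil (marg13 v) y y') BalBlock
  have h3 := card_filter_23 (t := t) (fun y y' => u < bil (marg23 v) y y') BalBlock
  calc #(heavySet v) ≤ _ := card_le_card hcov
    _ ≤ #((univ.filter fun x : Col t => (u < bil (marg12 v) x.1 x.2.1) ∧ BalBlock x.2.2) ∪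
          (univ.filter fun x : Col t => (u < bil (marg13 v) x.1 x.2.2) ∧ BalBlock x.2.1)) +
        #(univ.filter fun x : Col t => (u < bil (marg23 v) x.2.1 x.2.2) ∧ BalBlock x.1) := card_union_le _ _
    _ ≤ #(univ.filter fun x : Col t => (u < bil (marg12 v) x.1 x.2.1) ∧ BalBlock x.2.2) +
          #(univ.filter fun x : Col t => (u < bil (marg13 v) x.1 x.2.2) ∧ BalBlock x.2.1) +
        #(univ.filter fun x : Col t => (u < bil (marg23 v) x.2.1 x.2.2) ∧ BalBlock x.1) := by
          gcongr; exact card_union_le _ _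
    _ = #(balBlocks t) * (#(bigPairs (marg12 v) u) + #(bigPairs (marg13 v) u) + #(bigPairs (marg23 v) u)) := by
          rw [h1, h2, h3]; simp only [bigPairs, balBlocks]; ring

/-- **Pair count, registered form** (sub-goal `triangle_pair_count` of stmt-PneNP-10680). -/
theorem triangle_pair_count : ∀ {t : ℕ} (v : Tri t → ℝ), #(heavySet v) ≤ #(balBlocks t) * (#(bigPairs (marg12 v) (mass v / 3)) + #(bigPairs (marg13 v) (mass v / 3)) + #(bigPairs (marg23 v) (mass v / 3))) :=
  fun v => card_heavySet_le_pairs v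

end

end Summit.PneNP.PneNP.Theorems.XorDoor.TriLine.Heavy
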